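import Summits.AtomisticToContinuum.Crystallization.Theorems.ThreeConeCertificateSlackRigidityPricedFloorsGlobalize3

/-!
# Globalisation of exact local layerings, IV: reframing; the first shell of a configuration

Helper file for the stub `stub_globalize` of the line `priced-floors-palm-exactification`
(crux `ThreeConeCertificate.SlackRigidity`, item 11960): the exact local-to-global layer lemma
(Hales, *Dense Sphere Packings* §1.3, layer induction) for the admissible layered family of
item 13958.  This file: the reframing lemma (a linear isometry of `ℝ³` preserving the hexagon acts on coded points through one of the twelve hexagon symmetries and `±1` on heights), and the first shell `nbr S y` of an exactly layered configuration as the isometric image of the shell pattern (twelve points).  All `[folklore]`.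
-/

noncomputable section

open Set
open Literature.MathematicalPhysics.StatisticalMechanics
open Summit.AtomisticToContinuum.Crystallization.Theorems.SlackRigidityPricedFloors

namespace Summit.AtomisticToContinuum.Crystallization.Theorems.SlackRigidityPricedFloorsGlobalize

variable {a : ℝ}
/-! ## Reframing: linear isometries preserving the hexagon -/

/-- `typeSign = ±1`. [folklore] -/
theorem typeSign_cases (d : (ℤ × ℤ) × (ℤ × ℤ)) : typeSign d = 1 ∨ typeSign d = -1 := by
  unfold typeSign; split_ifs <;> simp

/-- Hexagon symmetries preserve the hexagon codes. [folklore] -/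
theorem image_hexCodes {d : (ℤ × ℤ) × (ℤ × ℤ)} (hd : d ∈ hexMats) :
    hexCodes.image (mapM d) = hexCodes := by
  revert d hd; decide

/-- Hexagon symmetries map hole triples to hole triples (of type multiplied by `typeSign`).
[folklore] -/
theorem image_upCodes {d : (ℤ × ℤ) × (ℤ × ℤ)} (hd : d ∈ hexMats) {σ : ℤ} (hσ : σ = 1 ∨ σ = -1) :
    (upCodes σ).image (mapM d) = upCodes (typeSign d * σ) := by
  have key : ∀ d ∈ hexMats, ∀ σ ∈ signs, (upCodes σ).image (mapM d) = upCodes (typeSign d * σ) := by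
    decide
  exact key d hd σ (mem_signs.2 hσ)

/-- Hexagon symmetries are nondegenerate. [folklore] -/
theorem det_ne_zero {d : (ℤ × ℤ) × (ℤ × ℤ)} (hd : d ∈ hexMats) :
    d.1.1 * d.2.2 - d.1.2 * d.2.1 ≠ 0 := by
  revert d hd; decide

/-- Dividing a hexagon code by `3`. [folklore] -/
theorem third_of_mem_hexCodes {c : ℤ × ℤ} (hc : c ∈ hexCodes) :
    (c.1 / 3, c.2 / 3) ∈ unitHex ∧ c = (3 * (c.1 / 3), 3 * (c.2 / 3)) := by
  revert c hc; decide

/-- `lat` is linear in the code. [folklore] -/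
theorem lat_eq_smul_add (a : ℝ) (c : ℤ × ℤ) :
    lat a c = ((c.1 : ℝ) / 3) • lat a (3, 0) + ((c.2 : ℝ) / 3) • lat a (0, 3) := by
  ext i; fin_cases i <;> simp [lat] <;> ring

/-- `lat (mapM d c) = c₁ lat d₁ + c₂ lat d₂`… in the form needed below. [folklore] -/
theorem lat_mapM (a : ℝ) (d : (ℤ × ℤ) × (ℤ × ℤ)) (c : ℤ × ℤ) :
    lat a (mapM d c) = ((c.1 : ℝ) / 3) • lat a (3 * d.1.1, 3 * d.1.2) +
      ((c.2 : ℝ) / 3) • lat a (3 * d.2.1, 3 * d.2.2) := by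
  ext i; fin_cases i <;> simp [lat, mapM] <;> ring

/-- Inner product with a lateral vector in coordinates. [folklore] -/
theorem inner_lat_right (g : E3) (a : ℝ) (c : ℤ × ℤ) :
    inner ℝ g (lat a c) = g 0 * (a * (2 * c.1 + c.2) / 6) + g 1 * (a * √3 * c.2 / 6) := by
  rw [Literature.Geometry.DiscreteGeometry.inner_fin3]; simp [lat]

/-- **Reframing lemma.** A linear isometry of `ℝ³` mapping the hexagon `lat '' hexCodes` into
itself acts on coded points through one of the twelve hexagon symmetries on the codes and
through `±1` on the heights. [folklore] -/
theorem reframe (ha : a ≠ 0) (G : E3 ≃ₗᵢ[ℝ] E3)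
    (hG : ∀ c ∈ hexCodes, G (lat a c) ∈ shellPart a hexCodes 0) :
    ∃ d ∈ hexMats, ∃ ε : ℝ, (ε = 1 ∨ ε = -1) ∧
      ∀ (c : ℤ × ℤ) (t : ℝ), G (lat a c + t • e3) = lat a (mapM d c) + (ε * t) • e3 := by
  obtain ⟨c₁, hc₁, e₁⟩ := exists_of_mem_shellPart (hG _ mem_hexCodes_basic.1)
  obtain ⟨c₂, hc₂, e₂⟩ := exists_of_mem_shellPart (hG _ mem_hexCodes_basic.2.2.1)
  rw [zero_smul, add_zero] at e₁ e₂
  obtain ⟨hu₁, hc₁'⟩ := third_of_mem_hexCodes hc₁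
  obtain ⟨hu₂, hc₂'⟩ := third_of_mem_hexCodes hc₂
  set d : (ℤ × ℤ) × (ℤ × ℤ) := ((c₁.1 / 3, c₁.2 / 3), (c₂.1 / 3, c₂.2 / 3)) with hd
  -- the action on lateral vectors
  have hlat : ∀ c : ℤ × ℤ, G (lat a c) = lat a (mapM d c) := by
    intro c
    rw [lat_eq_smul_add a c, map_add, map_smul, map_smul, e₁, e₂, lat_mapM, hc₁', hc₂']
  -- `d` is a hexagon symmetry
  have hdM : d ∈ hexMats := by
    simp only [hexMats, Finset.mem_filter, Finset.mem_product]
    refine ⟨⟨hu₁, hu₂⟩, ?_⟩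
    have h := hG _ mem_hexCodes_basic.2.2.2.2.1
    rw [show ((3 : ℤ), (-3 : ℤ)) = ((3 : ℤ), (0 : ℤ)) - ((0 : ℤ), (3 : ℤ)) by simp, lat_sub, map_sub,
      e₁, e₂, ← lat_sub, lat_eq_coded, coded_mem_shellPart_iff ha] at h
    have e : c₁ - c₂ = (3 * (d.1.1 - d.2.1), 3 * (d.1.2 - d.2.2)) := by
      rw [hc₁', hc₂']; ext <;> simp [hd] <;> ring
    rw [← e]; exact h.1
  -- the action on `e₃`
  set g : E3 := G e3 with hg
  have hi₁ : inner ℝ g (lat a c₁) = 0 := by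
    rw [hg, ← e₁, LinearIsometryEquiv.inner_map_map]; exact inner_e3_lat a _
  have hi₂ : inner ℝ g (lat a c₂) = 0 := by
    rw [hg, ← e₂, LinearIsometryEquiv.inner_map_map]; exact inner_e3_lat a _
  have hgn : ‖g‖ ^ 2 = 1 := by
    rw [hg, LinearIsometryEquiv.norm_map, Literature.Geometry.DiscreteGeometry.norm_sq_fin3]
    simp [e3]
  rw [inner_lat_right, hc₁'] at hi₁
  rw [inner_lat_right, hc₂'] at hi₂
  rw [Literature.Geometry.DiscreteGeometry.norm_sq_fin3] at hgn
  simp only [] at hi₁ hi₂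
  push_cast at hi₁ hi₂
  have hdet : ((d.1.1 * d.2.2 - d.1.2 * d.2.1 : ℤ) : ℝ) ≠ 0 := by exact_mod_cast det_ne_zero hdM
  push_cast at hdet
  have hs3 : (√3 : ℝ) ≠ 0 := by positivity
  simp only [hd] at hdet
  have hg0 : g 0 = 0 := by
    have h : g 0 * (a * (↑(c₁.1 / 3) * ↑(c₂.2 / 3) - ↑(c₁.2 / 3) * ↑(c₂.1 / 3))) = 0 := by
      linear_combination (↑(c₂.2 / 3) : ℝ) * hi₁ - (↑(c₁.2 / 3) : ℝ) * hi₂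
    rcases mul_eq_zero.1 h with h | h
    · exact h
    · exact absurd (mul_eq_zero.1 h |>.resolve_left ha) hdet
  have hg1 : g 1 = 0 := by
    rw [hg0] at hi₁ hi₂
    have h : g 1 * √3 * (a * (↑(c₁.1 / 3) * ↑(c₂.2 / 3) - ↑(c₁.2 / 3) * ↑(c₂.1 / 3))) = 0 := by
      linear_combination (2 * (↑(c₁.1 / 3) : ℝ)) * hi₂ - (2 * (↑(c₂.1 / 3) : ℝ)) * hi₁
    rcases mul_eq_zero.1 h with h | h
    · rcases mul_eq_zero.1 h with h | h
      · exact h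
      · exact absurd h hs3
    · exact absurd (mul_eq_zero.1 h |>.resolve_left ha) hdet
  rw [hg0, hg1] at hgn
  obtain ⟨ε, hε⟩ : ∃ ε : ℝ, g 2 = ε := ⟨_, rfl⟩
  rw [hε] at hgn
  have hg2 : ε = 1 ∨ ε = -1 := by
    have : (ε - 1) * (ε + 1) = 0 := by nlinarith
    rcases mul_eq_zero.1 this with h | h
    · exact Or.inl (by linarith)
    · exact Or.inr (by linarith)
  refine ⟨d, hdM, ε, hg2, fun c t => ?_⟩
  have hge : g = ε • e3 := by
    ext i; fin_cases i <;> simp [e3, hg0, hg1, hε]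
  rw [map_add, map_smul, hlat, ← hg, hge, smul_smul, mul_comm]

/-- Image of a shell part under a reframed isometry. [folklore] -/
theorem image_shellPart_of_reframe {G : E3 ≃ₗᵢ[ℝ] E3} {d : (ℤ × ℤ) × (ℤ × ℤ)} {ε : ℝ}
    (hGe : ∀ (c : ℤ × ℤ) (t : ℝ), G (lat a c + t • e3) = lat a (mapM d c) + (ε * t) • e3)
    (C : Finset (ℤ × ℤ)) (t : ℝ) :
    G '' shellPart a C t = shellPart a (C.image (mapM d)) (ε * t) := by
  rw [shellPart, shellPart, Set.image_image]
  ext v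
  constructor
  · rintro ⟨c, hc, rfl⟩
    exact ⟨mapM d c, Finset.mem_coe.2 (Finset.mem_image_of_mem _ hc), (hGe c t).symm⟩
  · rintro ⟨c', hc', rfl⟩
    obtain ⟨c, hc, rfl⟩ := Finset.mem_image.1 (Finset.mem_coe.1 hc')
    exact ⟨c, hc, hGe c t⟩

/-- **Image of the shell pattern under a reframed isometry**: again a shell pattern (types
multiplied by the type sign, heights by `ε`). [folklore] -/
theorem image_shellSet_of_reframe {G : E3 ≃ₗᵢ[ℝ] E3} {d : (ℤ × ℤ) × (ℤ × ℤ)} (hd : d ∈ hexMats)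
    {ε : ℝ} (hGe : ∀ (c : ℤ × ℤ) (t : ℝ), G (lat a c + t • e3) = lat a (mapM d c) + (ε * t) • e3)
    {σ₁ σ₂ : ℤ} (h₁ : σ₁ = 1 ∨ σ₁ = -1) (h₂ : σ₂ = 1 ∨ σ₂ = -1) (t₁ t₂ : ℝ) :
    G '' shellSet a σ₁ t₁ σ₂ t₂ =
      shellSet a (typeSign d * σ₁) (ε * t₁) (typeSign d * σ₂) (ε * t₂) := by
  simp only [shellSet, Set.image_union, image_shellPart_of_reframe hGe, image_hexCodes hd,
    image_upCodes hd h₁, image_upCodes hd h₂, mul_zero]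

/-! ## The first shell of an exactly layered configuration -/

section Site

variable {S : Set E3}

/-- **Local data at an exactly layered point**, unpacked: an isometry frame (upgraded to an
equivalence), admissible parameters, the two exactness clauses in the standard frame, and the
first shell as the image of the shell pattern. [folklore] -/
theorem site {y : E3} (h : ExactLayeredAt S y) :
    ∃ (A : E3 ≃ₗᵢ[ℝ] E3) (a : ℝ) (s : ℤ → ℤ) (z : ℤ → ℝ), IsAdmissibleLayering a s z ∧ z 0 = 0 ∧
      (∀ x ∈ S, dist x y ≤ 2 → A.symm (x - y) ∈ stdL a s z) ∧
      (∀ p ∈ stdL a s z, ‖p‖ ≤ 9 / 5 → y + A p ∈ S) ∧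
      nbr S y = A '' shellSet a (s 0) (z 1) (-s (-1)) (z (-1)) := by
  obtain ⟨A₀, a, s, z, hadm, hz0, hE1, hE2⟩ := h
  set A : E3 ≃ₗᵢ[ℝ] E3 := A₀.toLinearIsometryEquiv rfl with hA
  have hcoe : (A : E3 → E3) = A₀ := LinearIsometry.coe_toLinearIsometryEquiv A₀ rfl
  have hL : layeredSet A₀ a s z = A '' stdL a s z := by rw [layeredSet_eq_image, ← hcoe]
  refine ⟨A, a, s, z, hadm, hz0, ?_, ?_, ?_⟩
  · intro x hx hd
    have h1 := hE1 x hx hd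
    rw [hL] at h1
    obtain ⟨p, hp, hpx⟩ := h1
    rw [← hpx, A.symm_apply_apply]
    exact hp
  · intro p hp hn
    have h1 : A p ∈ layeredSet A₀ a s z := by rw [hL]; exact ⟨p, hp, rfl⟩
    exact hE2 _ h1 (by rwa [A.norm_map])
  · ext θ
    constructor
    · rintro ⟨hyθ, h0, hle⟩
      have h1 := hE1 (y + θ) hyθ (by rw [dist_eq_norm, add_sub_cancel_left]; linarith)
      rw [add_sub_cancel_left, hL] at h1
      obtain ⟨p, hp, rfl⟩ := h1
      refine ⟨p, mem_shellSet_of_norm_le hadm hz0 hp ?_ (by rwa [A.norm_map] at hle), rfl⟩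
      rintro rfl
      rw [map_zero, norm_zero] at h0
      exact lt_irrefl _ h0
    · rintro ⟨p, hp, rfl⟩
      have hs := hadm.2.2.1
      obtain ⟨h1, h2, -, -⟩ := abs_heights_of_adm hadm hz0
      have hσ : -s (-1) = 1 ∨ -s (-1) = -1 := by rcases hs (-1) with h | h <;> omega
      obtain ⟨hlo, hhi⟩ := norm_shell_bounds ⟨hadm.1, hadm.2.1⟩ (hs 0) hσ h1 h2 hp
      refine ⟨?_, by rw [A.norm_map]; linarith, by rw [A.norm_map]; linarith⟩
      have h3 : A p ∈ layeredSet A₀ a s z := by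
        rw [hL]; exact ⟨p, shellSet_subset_stdL hs hz0 hp, rfl⟩
      exact hE2 _ h3 (by rw [A.norm_map]; linarith)

/-- **Every first shell has twelve points.** [folklore] -/
theorem nbr_finite_ncard {y : E3} (h : ExactLayeredAt S y) :
    (nbr S y).Finite ∧ (nbr S y).ncard = 12 := by
  obtain ⟨A, a, s, z, hadm, hz0, -, -, hN⟩ := site h
  have ha1 := hadm.1
  have hs := hadm.2.2.1
  obtain ⟨-, -, hzp, hzn⟩ := abs_heights_of_adm hadm hz0
  have hσ : -s (-1) = 1 ∨ -s (-1) = -1 := by rcases hs (-1) with h | h <;> omega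
  rw [hN]
  refine ⟨(shellSet_finite _ _ _ _ _).image _, ?_⟩
  rw [Set.ncard_image_of_injective _ A.injective]
  exact ncard_shellSet (by linarith) (hs 0) hσ hzp.ne' hzn.ne (by linarith)

/-- A first shell containing another first shell equals it. [folklore] -/
theorem nbr_eq_of_subset {y y' : E3} (h : ExactLayeredAt S y) (h' : ExactLayeredAt S y')
    (hsub : nbr S y ⊆ nbr S y') : nbr S y' = nbr S y := by
  obtain ⟨-, h12⟩ := nbr_finite_ncard h
  obtain ⟨hfin, h12'⟩ := nbr_finite_ncard h'
  exact (Set.eq_of_subset_of_ncard_le hsub (by rw [h12, h12']) hfin).symm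

/-- Norm of a hexagon vector. [folklore] -/
theorem norm_lat_hex {b : ℝ} (hb : 0 < b) {c : ℤ × ℤ} (hc : c ∈ hexCodes) : ‖lat b c‖ = b := by
  have h2 : ‖lat b c‖ ^ 2 = b ^ 2 := by
    rw [norm_lat_sq, Qf_of_mem_hexCodes hc]; push_cast; ring
  exact (pow_left_inj₀ (norm_nonneg _) hb.le two_ne_zero).1 h2

/-- Norm of an isometric image of a hexagon vector. [folklore] -/
theorem norm_map_lat_hex (B : E3 ≃ₗᵢ[ℝ] E3) {b : ℝ} (hb : 0 < b) {c : ℤ × ℤ} (hc : c ∈ hexCodes) :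
    ‖B (lat b c)‖ = b := by
  rw [B.norm_map]; exact norm_lat_hex hb hc


end Site

/-- **Main statement of this file** (registered sub-goal `globalize_site_shell`). [folklore] -/
theorem globalize_site_shell : ∀ (S : Set E3) (y : E3), ExactLayeredAt S y → (nbr S y).Finite ∧ (nbr S y).ncard = 12 :=
  fun _ _ h => nbr_finite_ncard h

end Summit.AtomisticToContinuum.Crystallization.Theorems.SlackRigidityPricedFloorsGlobalize

end
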